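import Summits.CriticalPhenomena.PercolationContinuityZ3.Theses.PercDivergentSlabLadder
import Summits.CriticalPhenomena.PercolationContinuityZ3.Theorems.PercNonProliferationSubpolynomialBlockingStubTiling
import Summits.CriticalPhenomena.PercolationContinuityZ3.Theorems.PercNonProliferationSubpolynomialBlockingStubBlockerRSWGlue
import HarnessLib

/-!
# Crux `CubeBlockingSeed` (stmt-CriticalPhenomena-1141), line `registered` — STUB 1 `stub_tallSeed` from
`PercDivergentSlabLadder.FlatAnnulusCrossing` (stmt-CriticalPhenomena-6699)

Helper file of the line lead (`--supports stmt-CriticalPhenomena-1141`, registered sub-goal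
`stub_tallSeedOfFlatAnnulusCrossing`). The load-bearing open stub of the line is the TUBE SEED
`stub_tallSeed : ∃ k ≥ 1, ∃ c > 0, ∀ n ≥ 1, P_{p_c(ℤ³)}(no open path inside [0,kn]×[0,n]² from {x₀ = 0} to {x₀ = kn}) ≥ c`.
This file certifies that it is IMPLIED by an existing crux of another route of the same sub-problem,
`Summit.CriticalPhenomena.PercolationContinuityZ3.Theses.PercDivergentSlabLadder.FlatAnnulusCrossing`
(stmt-CriticalPhenomena-6699, "RSW for flat washers at ONE aspect ratio, uniformly in thickness": `∃ M, c > 0, ∀ k ≥ 1,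
∀ R ≥ M k`, the flat washer `{|z₀| ≤ k, R ≤ ρ ≤ 2R}`, `ρ = max(|z₁|,|z₂|)`, is crossed radially inside itself with
probability `≤ 1 − c` at `p_c(ℤ³)`), with `k = M + 1` and the same `c`:

* `crossing_subset_washer` (geometry, every configuration): lay the tube down — the box
  `B = Icc ![0, R, 0] ![n, 2R, n]` (thin direction `z₀`, long direction `z₁ ∈ [R, 2R]`, `0 ≤ n ≤ R`) lies in the
  washer `{|z₀| ≤ n, R ≤ ρ ≤ 2R}`, its face `{z₁ = R}` in `{ρ = R}` and its face `{z₁ = 2R}` in `{ρ = 2R}`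
  (`ρ = z₁` on `B`), so an open crossing of `B` between these faces inside `B` is a radial crossing of the washer
  inside the washer;
* `real_ge_one_sub_of_compl_subset` (measure bookkeeping, no measurability needed): `Aᶜ ⊆ S ⇒ P(S) ≥ 1 − P(A)`;
* `stub_tallSeedOfFlatAnnulusCrossing`: with `R = (M+1)·n ≥ M·n` and slab half-width `k = n`, the laid-down tube
  is sealed with probability `≥ 1 − (1 − c) = c`; the transposition `(0 1)` and the translation by `R e₁`
  (`SubpolynomialBlocking.StubTiling.real_seal_perm_shift`) carry it back to the upright tube
  `Icc 0 ![(M+1)n, n, n]` sealed across `x₀`, i.e. the registered text of `stub_tallSeed` with `k = M + 1`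
  (`SubpolynomialBlocking.StubBlockerRSWGlue.sealEvent_eq` converts the crux's `Finset.Icc` spelling).

Consequence for the line (recorded in the skeleton `Cruxes/CubeBlockingSeed/Lines/birth.lean`): the crux
`CubeBlockingSeed` follows from `FlatAnnulusCrossing` (6699) and the tall tilt comparison `stub_tallTilt` alone.
The converse `stub_tallSeed → FlatAnnulusCrossing` is NOT claimed (a radial crossing of a washer need not cross
any fixed tube lengthwise). No definitions; no unproved facts are used (6699 enters as a HYPOTHESIS).
-/

noncomputable section

namespace Summit.CriticalPhenomena.PercolationContinuityZ3.Theorems.CubeBlockingSeed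

open MeasureTheory Literature.Probability.Percolation Literature.Probability.LatticeModels
open Summit.CriticalPhenomena.PercolationContinuityZ3.Theses

namespace TallSeedOfFlatAnnulus

/-- Coordinatewise membership in an order box `Set.Icc lo hi` of `ℤ³`. [folklore] -/
theorem mem_setIcc3 {lo hi z : Site 3} :
    z ∈ Set.Icc lo hi ↔ (lo 0 ≤ z 0 ∧ lo 1 ≤ z 1 ∧ lo 2 ≤ z 2) ∧ (z 0 ≤ hi 0 ∧ z 1 ≤ hi 1 ∧ z 2 ≤ hi 2) := by
  simp [Set.mem_Icc, Pi.le_def, Fin.forall_fin_succ]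

/-- **Geometry of the laid-down tube.** For `0 ≤ n ≤ R`, an open crossing of the box
`B = Icc ![0, R, 0] ![n, 2R, n]` from its face `{z₁ = R}` to its face `{z₁ = 2R}` inside `B` is a radial
crossing, inside the flat washer `W = {|z₀| ≤ n, R ≤ max(|z₁|,|z₂|) ≤ 2R}`, from `{ρ = R}` to `{ρ = 2R}`:
`B ⊆ W` with `ρ = z₁` on `B` (as `0 ≤ z₂ ≤ n ≤ R ≤ z₁`; only `n ≤ R` is needed as a hypothesis, the box being
empty otherwise). [folklore] -/
theorem crossing_subset_washer {n R : ℤ} (hnR : n ≤ R) :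
    openCrossing (Set.Icc (![0, R, 0] : Site 3) ![n, 2 * R, n])
        {x | x ∈ Set.Icc (![0, R, 0] : Site 3) ![n, 2 * R, n] ∧ x 1 = R}
        {y | y ∈ Set.Icc (![0, R, 0] : Site 3) ![n, 2 * R, n] ∧ y 1 = 2 * R} ⊆
      {ω | ∃ x y : Site 3, max |x 1| |x 2| = R ∧ max |y 1| |y 2| = 2 * R ∧
        ω ∈ openConnIn {z : Site 3 | |z 0| ≤ n ∧ R ≤ max |z 1| |z 2| ∧ max |z 1| |z 2| ≤ 2 * R} x y} := by
  -- coordinates of a point of `B`, and its washer coordinates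
  have key : ∀ z : Site 3, z ∈ Set.Icc (![0, R, 0] : Site 3) ![n, 2 * R, n] →
      |z 0| ≤ n ∧ max |z 1| |z 2| = z 1 ∧ R ≤ z 1 ∧ z 1 ≤ 2 * R := by
    intro z hz
    rw [mem_setIcc3] at hz
    have h0 : 0 ≤ z 0 := by simpa using hz.1.1
    have h1 : R ≤ z 1 := by simpa using hz.1.2.1
    have h2 : 0 ≤ z 2 := by simpa using hz.1.2.2
    have h0' : z 0 ≤ n := by simpa using hz.2.1
    have h1' : z 1 ≤ 2 * R := by simpa using hz.2.2.1
    have h2' : z 2 ≤ n := by simpa using hz.2.2.2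
    refine ⟨abs_le.2 ⟨by omega, h0'⟩, ?_, h1, h1'⟩
    rw [abs_of_nonneg (show (0 : ℤ) ≤ z 1 by omega), abs_of_nonneg h2]
    exact max_eq_left (by omega)
  rintro ω ⟨x, ⟨hx, hx1⟩, y, ⟨hy, hy1⟩, hxy⟩
  obtain ⟨-, hxm, -, -⟩ := key x hx
  obtain ⟨-, hym, -, -⟩ := key y hy
  refine ⟨x, y, by rw [hxm, hx1], by rw [hym, hy1], openConnIn_mono (fun z hz => ?_) x y hxy⟩
  obtain ⟨hz0, hzm, hz1, hz1'⟩ := key z hz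
  exact ⟨hz0, by rw [hzm]; exact hz1, by rw [hzm]; exact hz1'⟩

/-- `Aᶜ ⊆ S ⇒ P(S) ≥ 1 − P(A)` for a probability measure (sub-additivity on `univ ⊆ A ∪ S`; no measurability
needed). [folklore] -/
theorem real_ge_one_sub_of_compl_subset {Ω : Type*} [MeasurableSpace Ω] (μ : Measure Ω)
    [IsProbabilityMeasure μ] {A S : Set Ω} (h : Aᶜ ⊆ S) : 1 - μ.real A ≤ μ.real S := by
  have hu : (Set.univ : Set Ω) ⊆ A ∪ S := fun ω _ => by
    by_cases hω : ω ∈ A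
    · exact Or.inl hω
    · exact Or.inr (h hω)
  have h1 : (1 : ℝ) ≤ μ.real A + μ.real S :=
    calc (1 : ℝ) = μ.real Set.univ := probReal_univ.symm
      _ ≤ μ.real (A ∪ S) := measureReal_mono hu
      _ ≤ μ.real A + μ.real S := measureReal_union_le A S
  linarith

end TallSeedOfFlatAnnulus

open TallSeedOfFlatAnnulus in
/-- **`stub_tallSeedOfFlatAnnulusCrossing`** (registered sub-goal of crux stmt-CriticalPhenomena-1141):
`PercDivergentSlabLadder.FlatAnnulusCrossing` (stmt-CriticalPhenomena-6699) implies the registered text of the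
line's load-bearing stub `stub_tallSeed`, with `k = M + 1` and the same constant `c`: at `p = p_c(ℤ³)`, for every
`n ≥ 1`, lay the tube `[0,(M+1)n] × [0,n]²` down into the washer `{|z₀| ≤ n, R ≤ ρ ≤ 2R}`, `R = (M+1)n ≥ M·n`
(`crossing_subset_washer`): a lengthwise open crossing of the tube would cross the washer radially, which has
probability `≤ 1 − c`; the transposition `(0 1)` + translation by `R e₁` (`real_seal_perm_shift`) and the
`Finset.Icc ↔ seal` dictionary (`sealEvent_eq`) return to the registered spelling. [folklore] -/
theorem stub_tallSeedOfFlatAnnulusCrossing :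
    PercDivergentSlabLadder.FlatAnnulusCrossing →
      ∃ k : ℕ, 1 ≤ k ∧ ∃ c : ℝ, 0 < c ∧ ∀ n : ℕ, 1 ≤ n →
      c ≤ (bondPercolation (zdGraph 3) (criticalProbI 3)).real
          {ω | ¬ ∃ x ∈ Finset.Icc (0 : Site 3) ![((k * n : ℕ) : ℤ), n, n],
            ∃ y ∈ Finset.Icc (0 : Site 3) ![((k * n : ℕ) : ℤ), n, n],
              x 0 = 0 ∧ y 0 = ((k * n : ℕ) : ℤ) ∧
                ω ∈ openConnIn ↑(Finset.Icc (0 : Site 3) ![((k * n : ℕ) : ℤ), n, n]) x y} := by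
  rintro ⟨M, c, hc, hW⟩
  refine ⟨M + 1, by omega, c, hc, fun n hn => ?_⟩
  rw [SubpolynomialBlocking.StubBlockerRSWGlue.sealEvent_eq]
  -- the washer bound at thickness k = n and inner radius R = (M+1) n ≥ M n
  have hWn := hW n ((M + 1) * n) hn (by nlinarith)
  -- lay the tube down: transposition (0 1), then translation by R e₁
  have hO := SubpolynomialBlocking.StubTiling.real_seal_perm_shift (criticalProbI 3) (Equiv.swap 0 1)
    ![0, (((M + 1) * n : ℕ) : ℤ), 0] 0 ![(((M + 1) * n : ℕ) : ℤ), n, n] 0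
  rw [Site.signedPerm_zero, zero_add,
    show Site.signedPerm (Equiv.swap (0 : Fin 3) 1) 1 (![(((M + 1) * n : ℕ) : ℤ), n, n] : Site 3) +
        ![0, (((M + 1) * n : ℕ) : ℤ), 0] = ![(n : ℤ), 2 * (((M + 1) * n : ℕ) : ℤ), n] from
      funext fun l => by fin_cases l <;> simp [Equiv.swap_apply_of_ne_of_ne, two_mul],
    show Equiv.swap (0 : Fin 3) 1 0 = 1 from Equiv.swap_apply_left 0 1] at hO
  simp only [Matrix.cons_val_zero, Matrix.cons_val_one, Pi.zero_apply] at hO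
  -- `hO : P(laid box sealed across z₁) = P(upright tube sealed across x₀)`
  rw [← hO]
  have hsub := crossing_subset_washer (n := (n : ℤ)) (R := (((M + 1) * n : ℕ) : ℤ))
    (by push_cast; nlinarith)
  calc c ≤ 1 - (bondPercolation (zdGraph 3) (criticalProbI 3)).real
        {ω | ∃ x y : Site 3, max |x 1| |x 2| = (((M + 1) * n : ℕ) : ℤ) ∧
          max |y 1| |y 2| = 2 * (((M + 1) * n : ℕ) : ℤ) ∧
          ω ∈ openConnIn {z : Site 3 | |z 0| ≤ (n : ℤ) ∧ (((M + 1) * n : ℕ) : ℤ) ≤ max |z 1| |z 2| ∧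
            max |z 1| |z 2| ≤ 2 * (((M + 1) * n : ℕ) : ℤ)} x y} := by linarith
    _ ≤ _ := real_ge_one_sub_of_compl_subset _ (Set.compl_subset_compl.2 hsub)

end Summit.CriticalPhenomena.PercolationContinuityZ3.Theorems.CubeBlockingSeed

end
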